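import Literature.Analysis.FluidPDE.WholeSpaceIBP
import Literature.Analysis.FluidPDE.HelmholtzAnnihilator
import Literature.Analysis.FluidPDE.NewtonKernel
import HarnessLib

/-!
# The Hessian–Laplacian identity `Σᵢⱼ ∫ (∂ᵢ∂ⱼG)² = ∫ (ΔG)²` for compactly supported functions

Analysis/FluidPDE support file (serves the discharge of the `L²` bound of the Riesz-type
singular integral behind the normalised pressure, `NS.stein1970_normalisedPressure_eLpNorm_le`,
via the Newtonian potential: `‖∂ᵢ∂ⱼ(Γ * g)‖_{L²} ≤ ‖Δ(Γ * g)‖_{L²} = ‖g‖_{L²}`).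

Let `E` be a finite-dimensional real inner product space with its Lebesgue measure and `b` an
orthonormal basis. For `G ∈ C³(E; ℝ)` with compact support, two applications of Green's first
identity without boundary (`Fluid.integral_inner_laplacian_add_eq_zero`) and the commutation
`Δ ∂ⱼ = ∂ⱼ Δ` (the tree's `Fluid.fderiv_laplacian_apply`, `FluidPDE/HelmholtzAnnihilator`; smoothness
of `ΔG` is `NS.contDiff_laplacian`, `FluidPDE/NewtonKernel`) give

  `Σᵢ Σⱼ ∫ (∂ⱼ∂ᵢ G)² = -Σᵢ ∫ Δ(∂ᵢG) ∂ᵢG = -Σᵢ ∫ ∂ᵢ(ΔG) ∂ᵢG = ∫ (ΔG)²`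

(`integral_sum_sq_fderiv_fderiv_eq_integral_laplacian_sq`), and by the Cauchy–Schwarz inequality in
the coefficients `∂ₐ∂ₐG = Σᵢⱼ aᵢaⱼ ∂ᵢ∂ⱼG`, `∫ (∂ₐ∂ₐ G)² ≤ |a|⁴ ∫ (ΔG)²`
(`integral_sq_fderiv_fderiv_apply_le`). This is the case `p = 2` (with the sharp constant
`A₂ = 1`) of Stein 1970, Ch. III §1.3, Proposition 3: for `f ∈ C²` with compact support,
`‖∂²f/∂xⱼ∂xₖ‖_p ≤ A_p ‖Δf‖_p`, `1 < p < ∞` (there via the Riesz transforms,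
`∂ⱼ∂ₖ f = -RⱼRₖΔf`; here by two integrations by parts, as in the proof of Gilbarg–Trudinger,
Thm 9.9); it is the elementary core of the `L²` theory of the second derivatives of the
Newtonian potential.

## Main statements

* `Literature.Analysis.FluidPDE.integral_sum_sq_fderiv_fderiv_eq_integral_laplacian_sq`: the identity.
* `Literature.Analysis.FluidPDE.sq_fderiv_fderiv_apply_le`: `(∂ₐ∂ₐG)² ≤ |a|⁴ Σᵢⱼ (∂ⱼ∂ᵢG)²` (pointwise, `C²`).
* `Literature.Analysis.FluidPDE.integral_sq_fderiv_fderiv_apply_le`: `∫ (∂ₐ∂ₐG)² ≤ |a|⁴ ∫ (ΔG)²`.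
* `Literature.Analysis.FluidPDE.integral_comp_sub_mul_fderiv_fderiv_apply`: two integrations by parts across a
  convolution, `∫ Φ(x-y) ∂ₐ∂ₐh(y) dy = ∫ (∂ₐ∂ₐΦ)(x-y) h(y) dy` (`Φ ∈ C²`, `h ∈ C²_c`).
* `Literature.Analysis.FluidPDE.laplacian_mul_eq`: `Δ(fg) = fΔg + gΔf + 2Σᵢ∂ᵢf∂ᵢg`, with the bound
  `|Σᵢ∂ᵢf∂ᵢg| ≤ ‖Df‖‖Dg‖` (`abs_sum_fderiv_mul_fderiv_le`).

## References

* E. M. Stein, *Singular integrals and differentiability properties of functions*, Princeton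
  Math. Series 30 (1970) (`Stein1971`), Ch. III §1.3, Proposition 3 (p. 53 of the held scan).
* D. Gilbarg, N. S. Trudinger, *Elliptic partial differential equations of second order*
  (2001), proof of Thm 9.9 (the Calderón–Zygmund inequality for `p = 2` by integration by
  parts).
-/

noncomputable section

open MeasureTheory Set Function InnerProductSpace
open scoped RealInnerProductSpace Laplacian ContDiff

namespace Literature.Analysis.FluidPDE

variable {E : Type*} [NormedAddCommGroup E] [InnerProductSpace ℝ E] [FiniteDimensional ℝ E]

/-! (Commuting `Δ` with a directional derivative, `∂ₐ(ΔG) = Δ(∂ₐG)` for `G ∈ C³`, is the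
tree's `Fluid.fderiv_laplacian_apply`, `FluidPDE/HelmholtzAnnihilator`.) -/

omit [FiniteDimensional ℝ E] in
/-- Expansion of a second directional derivative in an orthonormal basis:
`∂ₐ(∂ₐG)(x) = Σᵢ Σⱼ ⟨a,bᵢ⟩⟨a,bⱼ⟩ ∂ⱼ(∂ᵢG)(x)` for `G ∈ C²`. [folklore] -/
theorem fderiv_fderiv_apply_eq_sum {ι : Type*} [Fintype ι] (b : OrthonormalBasis ι ℝ E)
    {G : E → ℝ} (hG : ContDiff ℝ 2 G) (x a : E) :
    fderiv ℝ (fun y => fderiv ℝ G y a) x a =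
      ∑ i, ∑ j, (⟪a, b i⟫ * ⟪a, b j⟫) * fderiv ℝ (fun y => fderiv ℝ G y (b i)) x (b j) := by
  have hD1d : Differentiable ℝ (fderiv ℝ G) :=
    (hG.fderiv_right (m := 1) le_rfl).differentiable one_ne_zero
  have key : ∀ c d : E, fderiv ℝ (fun y => fderiv ℝ G y c) x d = fderiv ℝ (fderiv ℝ G) x d c :=
    fun c d => fderiv_apply_const_apply (hD1d x) c d
  simp_rw [key]
  set D2 := fderiv ℝ (fderiv ℝ G) x with hD2
  have ha : a = ∑ i, ⟪a, b i⟫ • b i := by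
    conv_lhs => rw [← b.sum_repr' a]
    exact Finset.sum_congr rfl fun i _ => by rw [real_inner_comm]
  conv_lhs => rw [ha]
  simp only [map_sum, map_smul, FunLike.coe_sum, Finset.sum_apply,
    FunLike.coe_smul, Pi.smul_apply, smul_eq_mul, Finset.mul_sum]
  refine Finset.sum_congr rfl fun i _ => Finset.sum_congr rfl fun j _ => ?_
  ring

omit [FiniteDimensional ℝ E] in
/-- **Cauchy–Schwarz in the coefficients:** `(∂ₐ∂ₐG)² ≤ |a|⁴ Σᵢ Σⱼ (∂ⱼ∂ᵢG)²` for `G ∈ C²`.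
[folklore] -/
theorem sq_fderiv_fderiv_apply_le {ι : Type*} [Fintype ι] (b : OrthonormalBasis ι ℝ E)
    {G : E → ℝ} (hG : ContDiff ℝ 2 G) (x a : E) :
    (fderiv ℝ (fun y => fderiv ℝ G y a) x a) ^ 2 ≤
      ‖a‖ ^ 4 * ∑ i, ∑ j, (fderiv ℝ (fun y => fderiv ℝ G y (b i)) x (b j)) ^ 2 := by
  rw [fderiv_fderiv_apply_eq_sum b hG x a]
  set M : ι → ι → ℝ := fun i j => fderiv ℝ (fun y => fderiv ℝ G y (b i)) x (b j) with hM
  have e1 : ∑ i, ∑ j, (⟪a, b i⟫ * ⟪a, b j⟫) * M i j =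
      ∑ p : ι × ι, (⟪a, b p.1⟫ * ⟪a, b p.2⟫) * M p.1 p.2 :=
    (Fintype.sum_prod_type' (fun i j => (⟪a, b i⟫ * ⟪a, b j⟫) * M i j)).symm
  have e2 : ∑ i, ∑ j, M i j ^ 2 = ∑ p : ι × ι, M p.1 p.2 ^ 2 :=
    (Fintype.sum_prod_type' (fun i j => M i j ^ 2)).symm
  have e3 : ∑ p : ι × ι, (⟪a, b p.1⟫ * ⟪a, b p.2⟫) ^ 2 = ‖a‖ ^ 4 := by
    rw [Fintype.sum_prod_type' (fun i j => (⟪a, b i⟫ * ⟪a, b j⟫) ^ 2)]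
    simp_rw [mul_pow]
    rw [← Finset.sum_mul_sum, b.sum_sq_inner_left a]
    ring
  rw [e1, e2]
  calc (∑ p : ι × ι, (⟪a, b p.1⟫ * ⟪a, b p.2⟫) * M p.1 p.2) ^ 2
      ≤ (∑ p : ι × ι, (⟪a, b p.1⟫ * ⟪a, b p.2⟫) ^ 2) * ∑ p : ι × ι, M p.1 p.2 ^ 2 :=
        Finset.sum_mul_sq_le_sq_mul_sq _ _ _
    _ = ‖a‖ ^ 4 * ∑ p : ι × ι, M p.1 p.2 ^ 2 := by rw [e3]

omit [FiniteDimensional ℝ E] in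
/-- Continuity of the second directional derivatives of a `C²` function. [folklore] -/
theorem continuous_fderiv_fderiv_apply {G : E → ℝ} (hG : ContDiff ℝ 2 G) (c d : E) :
    Continuous fun x => fderiv ℝ (fun y => fderiv ℝ G y c) x d :=
  (((hG.fderiv_right (m := 1) le_rfl).clm_apply contDiff_const).continuous_fderiv
    one_ne_zero).clm_apply continuous_const

omit [FiniteDimensional ℝ E] in
/-- Compact support of the second directional derivatives. [folklore] -/
theorem hasCompactSupport_fderiv_fderiv_apply {G : E → ℝ} (hc : HasCompactSupport G) (c d : E) :
    HasCompactSupport fun x => fderiv ℝ (fun y => fderiv ℝ G y c) x d :=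
  (hc.fderiv_apply ℝ c).fderiv_apply ℝ d

variable [MeasurableSpace E] [BorelSpace E]

/-- **The Hessian–Laplacian identity.** For `G ∈ C³(E; ℝ)` with compact support and an
orthonormal basis `b`, `Σᵢ Σⱼ ∫ (∂ⱼ∂ᵢG)² = ∫ (ΔG)²`: Green's first identity for the pair
`(∂ᵢG, ∂ᵢG)` gives `Σⱼ ∫ (∂ⱼ∂ᵢG)² = -∫ Δ(∂ᵢG) ∂ᵢG = -∫ ∂ᵢ(ΔG) ∂ᵢG`, and for the pair `(G, ΔG)`
it gives `∫ (ΔG)² = -Σᵢ ∫ ∂ᵢG ∂ᵢ(ΔG)`. (The `L²` case, with constant one, of Stein 1970, Ch. III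
§1.3 Prop. 3, `‖∂ⱼ∂ₖf‖_p ≤ A_p‖Δf‖_p` for `f ∈ C²_c`.) [cite: Stein1971, Ch. III §1.3 Prop 3] -/
theorem integral_sum_sq_fderiv_fderiv_eq_integral_laplacian_sq {ι : Type*} [Fintype ι]
    (b : OrthonormalBasis ι ℝ E) {G : E → ℝ} (hG : ContDiff ℝ 3 G) (hc : HasCompactSupport G) :
    ∑ i, ∑ j, ∫ x, (fderiv ℝ (fun y => fderiv ℝ G y (b i)) x (b j)) ^ 2 = ∫ x, ((Δ G) x) ^ 2 := by
  have hG2 : ContDiff ℝ 2 G := hG.of_le (by norm_num)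
  have hD1 : ContDiff ℝ 2 (fderiv ℝ G) := hG.fderiv_right (m := 2) le_rfl
  have hGi : ∀ i, ContDiff ℝ 2 fun y => fderiv ℝ G y (b i) := fun i => hD1.clm_apply contDiff_const
  have hci : ∀ i, HasCompactSupport fun y => fderiv ℝ G y (b i) := fun i => hc.fderiv_apply ℝ (b i)
  have hΔ1 : ContDiff ℝ 1 (Δ G) := FluidPDE.contDiff_laplacian (n := 1) (by exact_mod_cast hG)
  -- first Green identity, for each `i`
  have h1 : ∀ i, ∑ j, ∫ x, (fderiv ℝ (fun y => fderiv ℝ G y (b i)) x (b j)) ^ 2 =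
      -∫ x, fderiv ℝ (Δ G) x (b i) * fderiv ℝ G x (b i) := by
    intro i
    have h := integral_inner_laplacian_add_eq_zero b (hGi i) ((hGi i).of_le one_le_two)
      (Or.inl (hci i))
    have hlap : (fun x => ⟪(Δ fun y => fderiv ℝ G y (b i)) x, fderiv ℝ G x (b i)⟫) =
        fun x => fderiv ℝ (Δ G) x (b i) * fderiv ℝ G x (b i) := by
      funext x
      rw [← fderiv_laplacian_apply hG x (b i)]
      exact mul_comm _ _
    have hsq : ∀ j, (fun x => ⟪fderiv ℝ (fun y => fderiv ℝ G y (b i)) x (b j),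
        fderiv ℝ (fun y => fderiv ℝ G y (b i)) x (b j)⟫) =
        fun x => (fderiv ℝ (fun y => fderiv ℝ G y (b i)) x (b j)) ^ 2 := by
      intro j
      funext x
      rw [sq]
      rfl
    simp only [hlap, hsq] at h
    linarith
  -- second Green identity
  have h2 : ∫ x, ((Δ G) x) ^ 2 = -∑ i, ∫ x, fderiv ℝ (Δ G) x (b i) * fderiv ℝ G x (b i) := by
    have h := integral_inner_laplacian_add_eq_zero b hG2 hΔ1 (Or.inl hc)
    have hsq : (fun x => ⟪(Δ G) x, (Δ G) x⟫) = fun x => ((Δ G) x) ^ 2 := by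
      funext x
      rw [sq]
      rfl
    have hin : ∀ i, (fun x => ⟪fderiv ℝ G x (b i), fderiv ℝ (Δ G) x (b i)⟫) =
        fun x => fderiv ℝ (Δ G) x (b i) * fderiv ℝ G x (b i) := by
      intro i
      funext x
      rfl
    simp only [hsq, hin] at h
    linarith
  rw [h2, Finset.sum_congr rfl fun i _ => h1 i, Finset.sum_neg_distrib]

/-- **`∫ (∂ₐ∂ₐG)² ≤ |a|⁴ ∫ (ΔG)²`** for `G ∈ C³(E; ℝ)` with compact support (Stein 1970, Ch. III
§1.3 Prop. 3 with `p = 2`, `A₂ = 1`, for the direction `a`). [cite: Stein1971, Ch. III §1.3 Prop 3] -/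
theorem integral_sq_fderiv_fderiv_apply_le {G : E → ℝ} (hG : ContDiff ℝ 3 G)
    (hc : HasCompactSupport G) (a : E) :
    ∫ x, (fderiv ℝ (fun y => fderiv ℝ G y a) x a) ^ 2 ≤ ‖a‖ ^ 4 * ∫ x, ((Δ G) x) ^ 2 := by
  set b := stdOrthonormalBasis ℝ E
  have hG2 : ContDiff ℝ 2 G := hG.of_le (by norm_num)
  have hint : ∀ c d : E, Integrable (fun x => (fderiv ℝ (fun y => fderiv ℝ G y c) x d) ^ 2)
      (volume : Measure E) := fun c d => by
    have h1 : Continuous fun x => (fderiv ℝ (fun y => fderiv ℝ G y c) x d) ^ 2 :=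
      (continuous_fderiv_fderiv_apply hG2 c d).pow 2
    have h2 : HasCompactSupport fun x => (fderiv ℝ (fun y => fderiv ℝ G y c) x d) ^ 2 :=
      (hasCompactSupport_fderiv_fderiv_apply hc c d).comp_left (g := fun t : ℝ => t ^ 2)
        (by norm_num)
    exact h1.integrable_of_hasCompactSupport h2
  rw [← integral_sum_sq_fderiv_fderiv_eq_integral_laplacian_sq b hG hc]
  have e1 : ∀ i, ∑ j, ∫ x, (fderiv ℝ (fun y => fderiv ℝ G y (b i)) x (b j)) ^ 2 =
      ∫ x, ∑ j, (fderiv ℝ (fun y => fderiv ℝ G y (b i)) x (b j)) ^ 2 := fun i =>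
    (integral_finsetSum _ fun j _ => hint (b i) (b j)).symm
  have e2 : ∑ i, ∫ x, ∑ j, (fderiv ℝ (fun y => fderiv ℝ G y (b i)) x (b j)) ^ 2 =
      ∫ x, ∑ i, ∑ j, (fderiv ℝ (fun y => fderiv ℝ G y (b i)) x (b j)) ^ 2 :=
    (integral_finsetSum _ fun i _ => integrable_finsetSum _ fun j _ => hint (b i) (b j)).symm
  rw [Finset.sum_congr rfl fun i _ => e1 i, e2, ← integral_const_mul]
  refine integral_mono (hint a a) ?_ fun x => sq_fderiv_fderiv_apply_le b hG2 x a
  exact (integrable_finsetSum _ fun i _ => integrable_finsetSum _ fun j _ => hint _ _).const_mul _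

/-! ### Moving two derivatives across a convolution -/

omit [FiniteDimensional ℝ E] [MeasurableSpace E] [BorelSpace E] in
/-- Chain rule through the reflection `y ↦ x - y`: `∂ₐ[Φ(x - ·)](y) = -(∂ₐΦ)(x - y)` for
`Φ ∈ C¹`. [folklore] -/
theorem fderiv_comp_const_sub_apply {F : Type*} [NormedAddCommGroup F] [NormedSpace ℝ F]
    {Φ : E → F} (hΦ : ContDiff ℝ 1 Φ) (x y a : E) :
    fderiv ℝ (fun z => Φ (x - z)) y a = -fderiv ℝ Φ (x - y) a := by
  have h1 : HasFDerivAt (fun z : E => x - z) ((0 : E →L[ℝ] E) - ContinuousLinearMap.id ℝ E) y :=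
    (hasFDerivAt_const x y).sub (hasFDerivAt_id y)
  have h2 : HasFDerivAt Φ (fderiv ℝ Φ (x - y)) (x - y) :=
    (hΦ.differentiable one_ne_zero (x - y)).hasFDerivAt
  have h3 : HasFDerivAt (fun z => Φ (x - z))
      ((fderiv ℝ Φ (x - y)).comp ((0 : E →L[ℝ] E) - ContinuousLinearMap.id ℝ E)) y :=
    h2.comp y h1
  rw [h3.fderiv]
  simp

omit [FiniteDimensional ℝ E] [MeasurableSpace E] [BorelSpace E] in
/-- `Φ(x - ·)` is `Cⁿ` when `Φ` is. [folklore] -/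
theorem contDiff_comp_const_sub {F : Type*} [NormedAddCommGroup F] [NormedSpace ℝ F]
    {Φ : E → F} {n : ℕ∞} (hΦ : ContDiff ℝ n Φ) (x : E) : ContDiff ℝ n fun z => Φ (x - z) :=
  hΦ.comp (contDiff_const.sub contDiff_id)

/-- One integration by parts: `∫ Ψ ∂ₐk = -∫ ∂ₐΨ k` for `Ψ ∈ C¹`, `k ∈ C¹_c`. [folklore] -/
theorem integral_mul_fderiv_apply_eq_neg {Ψ k : E → ℝ} (hΨ : ContDiff ℝ 1 Ψ) (hk : ContDiff ℝ 1 k)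
    (hkc : HasCompactSupport k) (a : E) :
    ∫ y, Ψ y * fderiv ℝ k y a = -∫ y, fderiv ℝ Ψ y a * k y := by
  have hprod : ContDiff ℝ 1 fun y => Ψ y * k y := hΨ.mul hk
  have hpc : HasCompactSupport fun y => Ψ y * k y := hkc.mul_left
  have h0 := integral_fderiv_apply_eq_zero hprod hpc a
  have hpt : ∀ y, fderiv ℝ (fun y => Ψ y * k y) y a = fderiv ℝ Ψ y a * k y + Ψ y * fderiv ℝ k y a := by
    intro y
    rw [fderiv_fun_mul (hΨ.differentiable one_ne_zero y) (hk.differentiable one_ne_zero y)]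
    simp only [_root_.add_apply, FunLike.coe_smul, Pi.smul_apply,
      smul_eq_mul]
    ring
  simp_rw [hpt] at h0
  have hi1 : Integrable fun y => fderiv ℝ Ψ y a * k y :=
    (((hΨ.continuous_fderiv one_ne_zero).clm_apply continuous_const).mul hk.continuous)
      |>.integrable_of_hasCompactSupport hkc.mul_left
  have hi2 : Integrable fun y => Ψ y * fderiv ℝ k y a :=
    (hΨ.continuous.mul ((hk.continuous_fderiv one_ne_zero).clm_apply continuous_const))
      |>.integrable_of_hasCompactSupport (hkc.fderiv_apply ℝ a).mul_left
  rw [integral_add hi1 hi2] at h0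
  linarith

/-- **Two integrations by parts across a convolution:** for `Φ ∈ C²(E; ℝ)`, `h ∈ C²_c(E; ℝ)`,
every `x` and every direction `a`,
`∫ Φ(x - y) ∂ₐ∂ₐh(y) dy = ∫ (∂ₐ∂ₐΦ)(x - y) h(y) dy`
(no boundary terms; the two signs from the reflection cancel). [folklore] -/
theorem integral_comp_sub_mul_fderiv_fderiv_apply {Φ h : E → ℝ} (hΦ : ContDiff ℝ 2 Φ)
    (hh : ContDiff ℝ 2 h) (hc : HasCompactSupport h) (x a : E) :
    ∫ y, Φ (x - y) * fderiv ℝ (fun z => fderiv ℝ h z a) y a =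
      ∫ y, fderiv ℝ (fun z => fderiv ℝ Φ z a) (x - y) a * h y := by
  have hΦ1 : ContDiff ℝ 1 Φ := hΦ.of_le one_le_two
  have hh1 : ContDiff ℝ 1 h := hh.of_le one_le_two
  have hΦa : ContDiff ℝ 1 fun z => fderiv ℝ Φ z a :=
    (hΦ.fderiv_right (m := 1) le_rfl).clm_apply contDiff_const
  have hha : ContDiff ℝ 1 fun z => fderiv ℝ h z a :=
    (hh.fderiv_right (m := 1) le_rfl).clm_apply contDiff_const
  -- first integration by parts
  have step1 := integral_mul_fderiv_apply_eq_neg (contDiff_comp_const_sub hΦ1 x) hha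
    (hc.fderiv_apply ℝ a) a
  -- `∂ₐ[Φ(x - ·)] = -(∂ₐΦ)(x - ·)`
  have hD1 : ∀ y, fderiv ℝ (fun z => Φ (x - z)) y a = -fderiv ℝ Φ (x - y) a := fun y =>
    fderiv_comp_const_sub_apply hΦ1 x y a
  simp_rw [hD1] at step1
  -- second integration by parts, with `Ψ = (∂ₐΦ)(x - ·)`
  have step2 := integral_mul_fderiv_apply_eq_neg (contDiff_comp_const_sub hΦa x) hh1 hc a
  have hD2 : ∀ y, fderiv ℝ (fun z => fderiv ℝ Φ (x - z) a) y a =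
      -fderiv ℝ (fun z => fderiv ℝ Φ z a) (x - y) a := fun y =>
    fderiv_comp_const_sub_apply hΦa x y a
  simp_rw [hD2] at step2
  rw [step1]
  simp only [neg_mul, integral_neg, neg_neg] at step2 ⊢
  rw [step2]

/-! ### The Laplacian of a product -/

omit [MeasurableSpace E] [BorelSpace E] in
/-- **Leibniz rule for the Laplacian:** for `f, g ∈ C²(E; ℝ)` and an orthonormal basis `b`,
`Δ(fg) = f Δg + g Δf + 2 Σᵢ ∂ᵢf ∂ᵢg`. [folklore] -/
theorem laplacian_mul_eq {ι : Type*} [Fintype ι] (b : OrthonormalBasis ι ℝ E) {f g : E → ℝ}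
    (hf : ContDiff ℝ 2 f) (hg : ContDiff ℝ 2 g) (x : E) :
    (Δ fun y => f y * g y) x =
      f x * (Δ g) x + g x * (Δ f) x + 2 * ∑ i, fderiv ℝ f x (b i) * fderiv ℝ g x (b i) := by
  have hf1 : ContDiff ℝ 1 f := hf.of_le one_le_two
  have hg1 : ContDiff ℝ 1 g := hg.of_le one_le_two
  have hfd : ∀ y, DifferentiableAt ℝ f y := fun y => hf1.differentiable one_ne_zero y
  have hgd : ∀ y, DifferentiableAt ℝ g y := fun y => hg1.differentiable one_ne_zero y
  have hfa : ∀ c, ContDiff ℝ 1 fun y => fderiv ℝ f y c := fun c =>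
    (hf.fderiv_right (m := 1) le_rfl).clm_apply contDiff_const
  have hga : ∀ c, ContDiff ℝ 1 fun y => fderiv ℝ g y c := fun c =>
    (hg.fderiv_right (m := 1) le_rfl).clm_apply contDiff_const
  rw [laplacian_eq_sum_fderiv_fderiv b (hf.mul hg) x, laplacian_eq_sum_fderiv_fderiv b hf x,
    laplacian_eq_sum_fderiv_fderiv b hg x, Finset.mul_sum, Finset.mul_sum, Finset.mul_sum,
    ← Finset.sum_add_distrib, ← Finset.sum_add_distrib]
  refine Finset.sum_congr rfl fun i _ => ?_
  -- the first derivative of the product, as a function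
  have h1 : (fun y => fderiv ℝ (fun y => f y * g y) y (b i)) =
      fun y => fderiv ℝ f y (b i) * g y + f y * fderiv ℝ g y (b i) := by
    funext y
    rw [fderiv_fun_mul (hfd y) (hgd y)]
    simp only [_root_.add_apply, FunLike.coe_smul, Pi.smul_apply, smul_eq_mul]
    ring
  rw [h1]
  have hA : DifferentiableAt ℝ (fun y => fderiv ℝ f y (b i) * g y) x :=
    ((hfa (b i)).differentiable one_ne_zero x).mul (hgd x)
  have hB : DifferentiableAt ℝ (fun y => f y * fderiv ℝ g y (b i)) x :=
    (hfd x).mul ((hga (b i)).differentiable one_ne_zero x)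
  rw [fderiv_fun_add hA hB, fderiv_fun_mul ((hfa (b i)).differentiable one_ne_zero x) (hgd x),
    fderiv_fun_mul (hfd x) ((hga (b i)).differentiable one_ne_zero x)]
  simp only [_root_.add_apply, FunLike.coe_smul, Pi.smul_apply, smul_eq_mul]
  ring

omit [MeasurableSpace E] [BorelSpace E] in
/-- The cross term is the inner product of the gradients: `Σᵢ ∂ᵢf ∂ᵢg = ⟪∇f, ∇g⟫`, hence
`|Σᵢ ∂ᵢf ∂ᵢg| ≤ ‖Df‖ ‖Dg‖`. [folklore] -/
theorem abs_sum_fderiv_mul_fderiv_le {ι : Type*} [Fintype ι] (b : OrthonormalBasis ι ℝ E)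
    (f g : E → ℝ) (x : E) :
    |∑ i, fderiv ℝ f x (b i) * fderiv ℝ g x (b i)| ≤ ‖fderiv ℝ f x‖ * ‖fderiv ℝ g x‖ := by
  have hsum : ∑ i, fderiv ℝ f x (b i) * fderiv ℝ g x (b i) = ⟪gradient f x, gradient g x⟫ := by
    rw [← b.sum_inner_mul_inner (gradient f x) (gradient g x)]
    refine Finset.sum_congr rfl fun i _ => ?_
    rw [gradient, gradient, InnerProductSpace.toDual_symm_apply, real_inner_comm,
      InnerProductSpace.toDual_symm_apply]
  rw [hsum]
  calc |⟪gradient f x, gradient g x⟫| ≤ ‖gradient f x‖ * ‖gradient g x‖ :=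
        abs_real_inner_le_norm _ _
    _ = ‖fderiv ℝ f x‖ * ‖fderiv ℝ g x‖ := by
        rw [gradient, gradient, LinearIsometryEquiv.norm_map, LinearIsometryEquiv.norm_map]

end Literature.Analysis.FluidPDE
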